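import Literature.AlgebraicGeometry.Resolution.StrictNormalCrossingsOpen
import Mathlib.AlgebraicGeometry.Morphisms.FiniteType
import HarnessLib

/-!
# Door H2b (ALGEBRAIZE), part A2 — independence of differentials at ONE point spreads to a neighbourhood

Ring form (scheme form in the sequel): let `R` be of finite type over a perfect field `k`, `𝔭` a prime with
`R_𝔭` regular, and `a₁, …, a_r ∈ 𝔭` whose images in `R_𝔭` have linearly independent classes in `𝔪/𝔪²`
(part of a regular system of parameters). Then there is `f ∉ 𝔭` such that for EVERY prime `𝔮 ∌ f` containing
all `aᵢ`, the local ring `R_𝔮` is regular and the `aᵢ` have linearly independent classes in its cotangent space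
— i.e. `(aᵢ^{1/wᵢ})` is a regular weighted centre on the basic open `D(f)` (Włodarczyk 2.1.10, the
`linearIndependent` clause of `ReesAlgebraData.IsWeightedChart`). The proof re-runs the spreading argument of
`IsSNCIdeal.exists_notMem_forall` (`StrictNormalCrossingsOpen.lean`): openness of the regular loci of the
quotients `R/(aᵢ : i ∈ T)` (Matsumura, Cor. to Thm. 30.5), minimal primes near `𝔭`, and Thm. 14.2 in its
minimal form (`linearIndependent_toCotangent_of_isRegularLocalRing_quotient`).
-/

noncomputable section

open IsLocalRing CategoryTheory AlgebraicGeometry TopologicalSpace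

namespace Literature.AlgebraicGeometry.Resolution

universe u

/-! ## Transport of independence of differentials along isomorphisms of local rings -/

section Transport

variable {A B : Type*} [CommRing A] [CommRing B] [IsLocalRing A] [IsLocalRing B]

/-- Linear independence of the classes `dxᵢ ∈ 𝔪/𝔪²` is transported along an isomorphism of local rings
(criterion `linearIndependent_toCotangent_iff_forall_mem`): being «part of a regular system of parameters» is
intrinsic to the local ring. [cite: Matsumura1987, §14 Thm. 14.2 (regular system of parameters read in 𝔪/𝔪²)] -/
theorem linearIndependent_toCotangent_map_ringEquiv (e : A ≃+* B) {ι : Type*} [Fintype ι] (x : ι → A)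
    (hx : ∀ i, x i ∈ maximalIdeal A)
    (hli : LinearIndependent (ResidueField A) fun i => (maximalIdeal A).toCotangent ⟨x i, hx i⟩)
    (hex : ∀ i, e (x i) ∈ maximalIdeal B) :
    LinearIndependent (ResidueField B) fun i => (maximalIdeal B).toCotangent ⟨e (x i), hex i⟩ := by
  haveI : IsLocalHom (e : A →+* B) := ⟨fun a ha => by
    simpa using (ha.map (e.symm : B →+* A))⟩
  have hmax : (maximalIdeal A).map (e : A →+* B) = maximalIdeal B :=
    IsLocalRing.eq_maximalIdeal (Ideal.map_isMaximal_of_equiv e (p := maximalIdeal A))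
  rw [linearIndependent_toCotangent_iff_forall_mem] at hli ⊢
  intro c hc i
  -- pull the relation back along `e`
  have hc' : ∑ j, e.symm (c j) * x j ∈ maximalIdeal A ^ 2 := by
    have : e.symm (∑ j, c j * e (x j)) = ∑ j, e.symm (c j) * x j := by
      rw [map_sum]
      exact Finset.sum_congr rfl fun j _ => by rw [map_mul, RingEquiv.symm_apply_apply]
    rw [← this]
    have h2 : (maximalIdeal B ^ 2).map (e.symm : B →+* A) = maximalIdeal A ^ 2 := by
      rw [Ideal.map_pow, ← hmax, Ideal.map_map]
      simp [Ideal.map_id]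
    rw [← h2]
    exact Ideal.mem_map_of_mem _ hc
  have := hli _ hc' i
  have h3 : c i = e (e.symm (c i)) := (RingEquiv.apply_symm_apply e (c i)).symm
  have h4 : (e : A →+* B) (e.symm (c i)) ∈ (maximalIdeal A).map (e : A →+* B) := Ideal.mem_map_of_mem _ this
  rw [hmax] at h4
  rw [h3]
  exact h4

end Transport

/-! ## Spreading independence of differentials from a prime to a basic open neighbourhood -/

section Spread

variable {R : Type u} [CommRing R]

/-- **Independence of differentials spreads from a point to a neighbourhood** (ring form): `R` of finite
type over a perfect field `k`, `𝔭` a prime with `R_𝔭` regular, `a₁, …, a_r ∈ R` whose images lie in `𝔪_{R_𝔭}`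
with linearly independent classes in `𝔪/𝔪²`. Then there is `f ∉ 𝔭` such that for every prime `𝔮 ∌ f`
containing all `aᵢ`: `R_𝔮` is regular and the classes of the `aᵢ` in its cotangent space are linearly
independent. (So `(a₁^{1/w₁}, …, a_r^{1/w_r})` is a regular weighted centre on `D(f)` for any positive weights:
Włodarczyk 2.1.10.) [cite: Matsumura1987, Thm. 14.2 and §30 Cor. to Thm. 30.5; Wlodarczyk2022, 2.1.10] -/
theorem exists_notMem_forall_linearIndependent_toCotangent (k : Type u) [Field k] [PerfectField k]
    [Algebra k R] [Algebra.FiniteType k R] (𝔭 : Ideal R) [𝔭.IsPrime]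
    [IsRegularLocalRing (Localization.AtPrime 𝔭)] {r : ℕ} (a : Fin r → R)
    (ha : ∀ i, algebraMap R (Localization.AtPrime 𝔭) (a i) ∈ maximalIdeal (Localization.AtPrime 𝔭))
    (hli : LinearIndependent (ResidueField (Localization.AtPrime 𝔭)) fun i =>
      (maximalIdeal (Localization.AtPrime 𝔭)).toCotangent ⟨algebraMap R _ (a i), ha i⟩) :
    ∃ f ∉ 𝔭, ∀ (𝔮 : Ideal R) [𝔮.IsPrime], f ∉ 𝔮 → (∀ i, a i ∈ 𝔮) →
      IsRegularLocalRing (Localization.AtPrime 𝔮) ∧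
      ∃ h𝔮 : ∀ i, algebraMap R (Localization.AtPrime 𝔮) (a i) ∈ maximalIdeal (Localization.AtPrime 𝔮),
        LinearIndependent (ResidueField (Localization.AtPrime 𝔮)) fun i =>
          (maximalIdeal (Localization.AtPrime 𝔮)).toCotangent ⟨algebraMap R _ (a i), h𝔮 i⟩ := by
  classical
  haveI : IsNoetherianRing R := Algebra.FiniteType.isNoetherianRing k R
  set A := Localization.AtPrime 𝔭 with hA
  have ha𝔭 : ∀ i, a i ∈ 𝔭 := fun i => (IsLocalization.AtPrime.to_map_mem_maximal_iff A 𝔭 (a i)).mp (ha i)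
  -- the ideals `J T = (a i : i ∈ T)`; at `𝔭` their extensions are generated by elements with independent
  -- differentials
  let x' : Fin r → A := fun i => algebraMap R A (a i)
  let J : Finset (Fin r) → Ideal R := fun T => Ideal.span (a '' (T : Set (Fin r)))
  have hJA : ∀ T, (J T).map (algebraMap R A) = Ideal.span (x' '' (T : Set (Fin r))) := by
    intro T
    rw [Ideal.map_span, Set.image_image]
  have hJle : ∀ (T : Finset (Fin r)) (𝔮 : Ideal R), (∀ i ∈ T, a i ∈ 𝔮) → J T ≤ 𝔮 := by
    intro T 𝔮 hT
    rw [Ideal.span_le]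
    rintro _ ⟨i, hi, rfl⟩
    exact hT i hi
  have hJ𝔭 : ∀ T, J T ≤ 𝔭 := fun T => hJle T 𝔭 fun i _ => ha𝔭 i
  have hregJ : ∀ T, IsRegularLocalRing (A ⧸ (J T).map (algebraMap R A)) := by
    intro T
    haveI := isRegularLocalRing_quotient_span_image_of_linearIndependent_toCotangent x' ha hli
      (T : Set (Fin r))
    exact IsRegularLocalRing.of_ringEquiv (Ideal.quotEquivOfEq (hJA T).symm)
  -- (a) regular loci of the `R / J T` around `𝔭`
  choose g hg hgreg using fun T : Finset (Fin r) =>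
    exists_notMem_forall_isRegularLocalRing_quotient k (J T) 𝔭 (hJ𝔭 T) (hregJ T)
  -- (b) minimal primes of the `J T` near `𝔭` lie inside `𝔭`
  choose hm hhm hhmin using fun T : Finset (Fin r) =>
    Ideal.exists_notMem_forall_minimalPrimes_le (J T) 𝔭
  refine ⟨∏ T, (g T * hm T), prod_mem (S := 𝔭.primeCompl) fun T _ => mul_mem (hg T) (hhm T),
    fun 𝔮 _ hf𝔮 ha𝔮 => ?_⟩
  set B := Localization.AtPrime 𝔮 with hB
  have hg𝔮 : ∀ T, g T ∉ 𝔮 := fun T =>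
    notMem_of_dvd_of_notMem ((dvd_mul_right _ _).trans
      (Finset.dvd_prod_of_mem (fun T => g T * hm T) (Finset.mem_univ T))) hf𝔮
  have hhm𝔮 : ∀ T, hm T ∉ 𝔮 := fun T =>
    notMem_of_dvd_of_notMem ((dvd_mul_left _ _).trans
      (Finset.dvd_prod_of_mem (fun T => g T * hm T) (Finset.mem_univ T))) hf𝔮
  let z : Fin r → B := fun i => algebraMap R B (a i)
  have hz : ∀ i, z i ∈ maximalIdeal B := fun i =>
    (IsLocalization.AtPrime.to_map_mem_maximal_iff B 𝔮 _).mpr (ha𝔮 i)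
  have hspanS : ∀ S : Finset (Fin r), Ideal.span (z '' (S : Set (Fin r))) = (J S).map (algebraMap R B) := by
    intro S
    rw [Ideal.map_span, Set.image_image]
  have hJ𝔮 : ∀ S : Finset (Fin r), J S ≤ 𝔮 := fun S => hJle _ 𝔮 fun i _ => ha𝔮 i
  -- (a) at `𝔮`: the quotients `B / (z_S)` are regular
  have hregS : ∀ S : Finset (Fin r), IsRegularLocalRing (B ⧸ (J S).map (algebraMap R B)) :=
    fun S => hgreg _ 𝔮 (hg𝔮 _) (hJ𝔮 S)
  haveI : IsRegularLocalRing (B ⧸ Ideal.span (Set.range z)) := by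
    rw [← Set.image_univ, ← Finset.coe_univ, hspanS]
    exact hregS _
  -- `B` itself is regular (`S = ∅`)
  haveI hregB : IsRegularLocalRing B := by
    have h0 := hregS ∅
    rw [← hspanS, Finset.coe_empty, Set.image_empty, Ideal.span_empty] at h0
    exact IsRegularLocalRing.of_ringEquiv (RingEquiv.quotientBot B)
  -- minimality: no `z j` lies in the ideal of the others
  have hmin : ∀ j, z j ∉ Ideal.span (z '' {j' | j' ≠ j}) := by
    intro j
    have hset : ({j' | j' ≠ j} : Set (Fin r)) = ((Finset.univ.erase j : Finset (Fin r)) : Set (Fin r)) := by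
      ext j'
      simp
    rw [hset, hspanS]
    refine algebraMap_notMem_map_span_image 𝔭 𝔮 a ha hli _ ?_ (hregS _) ?_
    · intro hi
      exact (Finset.mem_erase.mp hi).1 rfl
    · intro P hP hP𝔮
      exact hhmin _ P hP fun hh => hhm𝔮 _ (hP𝔮 hh)
  exact ⟨hregB, hz, linearIndependent_toCotangent_of_isRegularLocalRing_quotient z hz hmin⟩

end Spread

/-! ## Scheme form: a weighted chart around a point where the parameters are part of a regular system -/

section SchemeForm

/-- **Independence of differentials spreads from a point to an affine neighbourhood** (scheme form, the
`linearIndependent` clause of a weighted chart, Włodarczyk 2.1.10): `Y` locally of finite type over a perfect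
field `k`, `U ⊆ Y` an affine open, `y ∈ U` with `𝒪_{Y,y}` regular, and sections `u₁, …, u_m ∈ Γ(Y, U)`
vanishing at `y` whose germs have linearly independent classes in `𝔪_y/𝔪_y²`. Then there is an affine open
`y ∈ V ⊆ U` such that at EVERY point `y' ∈ V` where all `uᵢ` vanish, `𝒪_{Y,y'}` is regular and the germs of the
`uᵢ|_V` have linearly independent classes in `𝔪_{y'}/𝔪_{y'}²`.
[cite: Matsumura1987, Thm. 14.2 and §30 Cor. to Thm. 30.5; Wlodarczyk2022, 2.1.10] -/
theorem exists_affineOpens_forall_linearIndependent_toCotangent {k : Type u} [Field k] [PerfectField k]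
    {Y : Scheme.{u}} (f : Y ⟶ Spec (.of k)) [LocallyOfFiniteType f] (U : Y.affineOpens) {y : Y}
    (hy : y ∈ (U : Y.Opens)) [IsRegularLocalRing (Y.presheaf.stalk y)] {m : ℕ} (u : Fin m → Γ(Y, U))
    (hu : ∀ i, (Y.presheaf.germ (U : Y.Opens) y hy).hom (u i) ∈ maximalIdeal (Y.presheaf.stalk y))
    (hli : LinearIndependent (ResidueField (Y.presheaf.stalk y))
      fun i => (maximalIdeal (Y.presheaf.stalk y)).toCotangent ⟨_, hu i⟩) :
    ∃ (V : Y.affineOpens) (hVU : (V : Y.Opens) ≤ U), y ∈ (V : Y.Opens) ∧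
      ∀ (y' : Y) (hy' : y' ∈ (V : Y.Opens))
        (h : ∀ i, (Y.presheaf.germ (V : Y.Opens) y' hy').hom ((Y.presheaf.map (homOfLE hVU).op).hom (u i)) ∈
          maximalIdeal (Y.presheaf.stalk y')),
        IsRegularLocalRing (Y.presheaf.stalk y') ∧
        LinearIndependent (ResidueField (Y.presheaf.stalk y'))
          fun i => (maximalIdeal (Y.presheaf.stalk y')).toCotangent ⟨_, h i⟩ := by
  classical
  -- the coordinate ring `Γ(Y, U)` is of finite type over `k`
  have hft : RingHom.FiniteType (f.appLE ⊤ U le_top).hom :=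
    HasRingHomProperty.appLE @LocallyOfFiniteType f ‹_› ⟨⊤, isAffineOpen_top _⟩ U le_top
  let φ : k →+* Γ(Y, U) := (f.appLE ⊤ U le_top).hom.comp (Scheme.ΓSpecIso (.of k)).inv.hom
  have hφ : φ.FiniteType :=
    hft.comp (RingHom.FiniteType.of_surjective _
      (Scheme.ΓSpecIso (.of k)).commRingCatIsoToRingEquiv.symm.surjective)
  letI : Algebra k Γ(Y, U) := φ.toAlgebra
  haveI : Algebra.FiniteType k Γ(Y, U) := hφ
  -- the prime `𝔭` of `y`; `𝒪_{Y,y}` is the localisation of `Γ(Y, U)` at `𝔭`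
  set 𝔭 := (U.2.primeIdealOf ⟨y, hy⟩).asIdeal with h𝔭
  haveI h𝔭p : 𝔭.IsPrime := (U.2.primeIdealOf ⟨y, hy⟩).isPrime
  letI algy : Algebra Γ(Y, U) (Y.presheaf.stalk y) :=
    TopCat.Presheaf.algebra_section_stalk Y.presheaf (⟨y, hy⟩ : (U : Y.Opens))
  haveI hlocy : IsLocalization.AtPrime (Y.presheaf.stalk y) 𝔭 := U.2.isLocalization_stalk ⟨y, hy⟩
  have halg : ∀ s : Γ(Y, U), algebraMap Γ(Y, U) (Y.presheaf.stalk y) s =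
      (Y.presheaf.germ (U : Y.Opens) y hy).hom s := fun _ => rfl
  let e : Y.presheaf.stalk y ≃ₐ[Γ(Y, U)] Localization.AtPrime 𝔭 :=
    IsLocalization.algEquiv 𝔭.primeCompl (Y.presheaf.stalk y) (Localization.AtPrime 𝔭)
  haveI : IsRegularLocalRing (Localization.AtPrime 𝔭) := IsRegularLocalRing.of_ringEquiv e.toRingEquiv
  have he : ∀ i, e.toRingEquiv ((Y.presheaf.germ (U : Y.Opens) y hy).hom (u i)) =
      algebraMap Γ(Y, U) (Localization.AtPrime 𝔭) (u i) := fun i => by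
    rw [← halg (u i)]
    exact e.commutes (u i)
  have ha : ∀ i, algebraMap Γ(Y, U) (Localization.AtPrime 𝔭) (u i) ∈ maximalIdeal (Localization.AtPrime 𝔭) := by
    intro i
    rw [← he i]
    exact map_nonunit (e.toRingEquiv : Y.presheaf.stalk y →+* Localization.AtPrime 𝔭) _ (hu i)
  have hli' : LinearIndependent (ResidueField (Localization.AtPrime 𝔭)) fun i =>
      (maximalIdeal (Localization.AtPrime 𝔭)).toCotangent ⟨algebraMap Γ(Y, U) _ (u i), ha i⟩ := by
    have h1 := linearIndependent_toCotangent_map_ringEquiv e.toRingEquiv _ hu hli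
      (fun i => by rw [he i]; exact ha i)
    convert h1 using 3 with i
    exact Subtype.ext (he i).symm
  -- the ring-level spreading
  obtain ⟨g, hg𝔭, hspread⟩ := exists_notMem_forall_linearIndependent_toCotangent k 𝔭 u ha hli'
  -- the basic open `V = U ∩ D(g)`
  let V : Y.affineOpens := ⟨Y.basicOpen g, U.2.basicOpen g⟩
  have hVU : (V : Y.Opens) ≤ U := Y.basicOpen_le g
  refine ⟨V, hVU, ?_, fun y' hy' h => ?_⟩
  · -- `y ∈ D(g)` since `g ∉ 𝔭`
    show y ∈ Y.basicOpen g
    rw [Scheme.mem_basicOpen Y g y hy, ← halg g]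
    exact (IsLocalization.AtPrime.isUnit_to_map_iff (Y.presheaf.stalk y) 𝔭 g).mpr hg𝔭
  · have hy'U : y' ∈ (U : Y.Opens) := hVU hy'
    set 𝔮 := (U.2.primeIdealOf ⟨y', hy'U⟩).asIdeal with h𝔮
    haveI h𝔮p : 𝔮.IsPrime := (U.2.primeIdealOf ⟨y', hy'U⟩).isPrime
    letI algy' : Algebra Γ(Y, U) (Y.presheaf.stalk y') :=
      TopCat.Presheaf.algebra_section_stalk Y.presheaf (⟨y', hy'U⟩ : (U : Y.Opens))
    haveI hlocy' : IsLocalization.AtPrime (Y.presheaf.stalk y') 𝔮 := U.2.isLocalization_stalk ⟨y', hy'U⟩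
    have halg' : ∀ s : Γ(Y, U), algebraMap Γ(Y, U) (Y.presheaf.stalk y') s =
        (Y.presheaf.germ (U : Y.Opens) y' hy'U).hom s := fun _ => rfl
    -- `g ∉ 𝔮` since `y' ∈ D(g)`
    have hg𝔮 : g ∉ 𝔮 := by
      have hy'g : y' ∈ Y.basicOpen g := hy'
      have hunit : IsUnit ((Y.presheaf.germ (U : Y.Opens) y' hy'U).hom g) :=
        (Scheme.mem_basicOpen Y g y' hy'U).mp hy'g
      rw [← halg' g] at hunit
      exact (IsLocalization.AtPrime.isUnit_to_map_iff (Y.presheaf.stalk y') 𝔮 g).mp hunit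
    -- germs along the restriction `V ≤ U`
    have hgerm : ∀ i, (Y.presheaf.germ (V : Y.Opens) y' hy').hom ((Y.presheaf.map (homOfLE hVU).op).hom (u i)) =
        (Y.presheaf.germ (U : Y.Opens) y' hy'U).hom (u i) := fun i =>
      TopCat.Presheaf.germ_res_apply Y.presheaf (homOfLE hVU) y' hy' (u i)
    -- the `u i` lie in `𝔮` since their germs at `y'` are not units
    have hu𝔮 : ∀ i, u i ∈ 𝔮 := by
      intro i
      have hi := h i
      rw [hgerm i, ← halg' (u i)] at hi
      exact (IsLocalization.AtPrime.to_map_mem_maximal_iff (Y.presheaf.stalk y') 𝔮 (u i)).mp hi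
    obtain ⟨hreg𝔮, ha𝔮, hli𝔮⟩ := hspread 𝔮 hg𝔮 hu𝔮
    -- transport back along `𝒪_{Y,y'} ≅ Γ(Y, U)_𝔮`
    let e' : Localization.AtPrime 𝔮 ≃ₐ[Γ(Y, U)] Y.presheaf.stalk y' :=
      (IsLocalization.algEquiv 𝔮.primeCompl (Y.presheaf.stalk y') (Localization.AtPrime 𝔮)).symm
    have he' : ∀ i, e'.toRingEquiv (algebraMap Γ(Y, U) (Localization.AtPrime 𝔮) (u i)) =
        (Y.presheaf.germ (V : Y.Opens) y' hy').hom ((Y.presheaf.map (homOfLE hVU).op).hom (u i)) := by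
      intro i
      rw [hgerm i, ← halg' (u i)]
      exact e'.commutes (u i)
    refine ⟨IsRegularLocalRing.of_ringEquiv e'.toRingEquiv, ?_⟩
    have h1 := linearIndependent_toCotangent_map_ringEquiv e'.toRingEquiv _ ha𝔮 hli𝔮
      (fun i => by rw [he' i]; exact h i)
    convert h1 using 3 with i
    exact Subtype.ext (he' i).symm

end SchemeForm

end Literature.AlgebraicGeometry.Resolution

end
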